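/- Copyright: the b2b-balaban cell (near-miss cell 7), T⁴-continuum fan-out, lineage t4-ne7b-formalise-leaf-04 (NE7b
ROUND-2 crew, leaf prover 04).  Released under the licence of the surrounding project. -/
import Summits.QuantumFields.BalabanUV.T4Continuum.Support.B16HistoryIndexedRepr

/-!
# The cutoff-indexed family of history-indexed expansions and the END's term-family SHAPE — re-open object (α) of row
NE7b, `SCOPE-alpha.md` v2.2 §5 row M2, brick A (the source-free index set `T K`, the source-dependent weights
`A K t τ := ∫ eterm`, and `Z(t) = Σ_{τ ∈ T K} A K t τ` from the displayed per-level `Holds` + integrability) —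
PRE-POSITIONING ONLY; lineage `t4-ne7b-formalise-leaf-04` gen 23 (crux node NE7b, route R-P1)

Summits-side support leaf of the T⁴-continuum cell (rung (B)+1 on a FINITE torus only; NOT infinite volume, NOT the
mass gap, NOT Clay; NOT a proof of NE7b — the cell's OWN estimate, NOT PRINTED, NOT PROVED).  [folklore] measure-theory
bookkeeping (Mathlib `integral_finsetSum`) over M1 (`B16HistoryIndexedRepr`: `HIndex`, `Repr172R`, `eterm`,
`holds_iff_sum_eterm`); nothing printed asserted, no `def … : Prop` fact of Bałaban's, no cite-tagged hypothesis, zero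
`sorry`.

WHAT.  The END of row NE7b (`HistoryRealiseCellsRunApexT3b.CountRoadWitnessT3b`) reads each loop string's two dressed
partition functions as FINITE TERM FAMILIES: ONE source-free index set `T K : Finset ι` per cutoff `K` (shared by run A,
`K` steps, and run B, `K + 1` steps — NODE O's synchronised term data) and source-dependent weights `A K t τ`,
`A' K t τ`, with `reprA : Z_A(K,t) = Σ_{τ ∈ T K} A K t τ` (idem B).  Given, per cutoff, ONE index skeleton `I K : HIndex`
(M1) and, per run and source value `t`, the (1.72) operations `R K t : Repr172R (𝒢 K) (I K)` of the final DRESSED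
density on the run's unit-lattice configuration space `X K` (H2's dressed run, T4-DAG §0), this file defines the
K-uniform index type `Idx I = Σ K, Σ a, HZ × HL × HC`, the term set `termSet I K` (the level's full index set
`Σ_a LIdx a` tagged by `K`), the weights `weight μ R t τ := ∫ eterm dμ_{K(τ)}`, and proves `card_termSet`,
`sum_termSet` (re-indexing), **`integral_eq_sum_weight`**: «(1.72) holds» `∀ V, ρ V = Σ_a (R K t).term a V` + integrability of the elementary
terms ⟹ `∫ ρ dμ_K = Σ_{τ ∈ termSet I K} weight μ R t τ`, and the junction **`repr_of_holds`**: any displayed identity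
`Z = ∫ ρ dμ_K` (H2's bookkeeping identity `Z_ε(t) = ∫ρ₀^t dU = ∫ρ_K^t dV_K`, by name from its supplier) gives the END's
`repr` equation for that run.  Two runs over ONE skeleton = two operation families `RA RB` (`repr_pair_of_holds`).

NOT HERE (honest).  Which skeleton and which operations are Bałaban's (the READING: M2 brick B = the level-indexed
admissible sequences along `T4Continuum.Realisation`, M4 = the genealogy junction); H2's identity itself (displayed);
integrability of the elementary terms (displayed — on a compact group with bounded measurable data it is routine, but
M1's operations are abstract); any estimate.  BY-NAME EFFECT ON THE WALL: NONE.

HONEST DEPENDENCY (cell): continuum YM on T⁴ ⇐ BetaPertH ∧ nine spine estimates (0/9 proved); BetaPertH ⇐ (D1) ∧ (D4)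
∧ CAP+tail; G-an2-4 gates asym, D1 and NE2/3/4.  This file changes none of it.
-/

open Finset MeasureTheory
open Literature.MathematicalPhysics.QuantumFieldTheory.Balaban1983to89

namespace Summit.QuantumFields.BalabanUV.T4Continuum.B16HistoryIndexedRepr

namespace HIndex

variable {DomK : ℕ → Type*}

/-- The K-UNIFORM INDEX TYPE of the term families: a term is (its cutoff `K`, its outer summand `a`, its history choice
`(h, ℓ, c)`). [folklore] -/
def Idx (I : (K : ℕ) → HIndex (DomK K)) : Type _ :=
  Σ K, Σ _ : (I K).Adm, (I K).HZ × (I K).HL × (I K).HC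

/-- The level's full index set `Σ_a LIdx a` of the cutoff-`K` skeleton. [folklore] -/
def levelSet (I : (K : ℕ) → HIndex (DomK K)) (K : ℕ) : Finset (Σ _ : (I K).Adm, (I K).HZ × (I K).HL × (I K).HC) :=
  (Finset.univ : Finset (I K).Adm).sigma (I K).LIdx

/-- **THE SOURCE-FREE TERM SET `T K`**: the level's full index set tagged by the cutoff, inside the K-uniform type.
[folklore] -/
def termSet (I : (K : ℕ) → HIndex (DomK K)) (K : ℕ) : Finset (Idx I) :=
  (levelSet I K).map (Function.Embedding.sigmaMk (β := fun K => Σ _ : (I K).Adm, (I K).HZ × (I K).HL × (I K).HC) K)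

/-- Every term of `T K` carries the tag `K`. [folklore] -/
theorem fst_eq_of_mem_termSet (I : (K : ℕ) → HIndex (DomK K)) {K : ℕ} {τ : Idx I} (hτ : τ ∈ termSet I K) :
    τ.1 = K := by
  obtain ⟨p, -, rfl⟩ := Finset.mem_map.mp hτ
  rfl

/-- `T K` has as many terms as the level's full index set (the tagging is injective). [folklore] -/
theorem card_termSet (I : (K : ℕ) → HIndex (DomK K)) (K : ℕ) : (termSet I K).card = (levelSet I K).card :=
  Finset.card_map _

/-- Re-indexing a sum over `T K` as the double sum over the level's summands and history choices. [folklore] -/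
theorem sum_termSet (I : (K : ℕ) → HIndex (DomK K)) (K : ℕ) (f : Idx I → ℝ) :
    ∑ τ ∈ termSet I K, f τ = ∑ a : (I K).Adm, ∑ ι ∈ (I K).LIdx a, f ⟨K, a, ι⟩ := by
  unfold termSet levelSet
  rw [Finset.sum_map, Finset.sum_sigma]
  rfl

end HIndex

namespace Repr172R

variable {DomK : ℕ → Type*} {I : (K : ℕ) → HIndex (DomK K)} {X : ℕ → Type*} [∀ K, MeasurableSpace (X K)]
  {𝒢 : (K : ℕ) → GoodClass (X K)}

/-- **THE SOURCE-DEPENDENT WEIGHTS `A K t τ`**: the integral of the elementary term of `τ = (K, a, (h,ℓ,c))` under the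
cutoff-`K` run's reference measure, for the operations `R K t` of the source value `t` (the tag of `τ` selects the
cutoff; no transport). [folklore] -/
noncomputable def weight (μ : (K : ℕ) → Measure (X K)) (R : (K : ℕ) → ℝ → Repr172R (𝒢 K) (I K)) (t : ℝ) :
    HIndex.Idx I → ℝ
  | ⟨K, a, ι⟩ => ∫ x, (R K t).eterm a ι x ∂(μ K)

/-- **THE TOTAL INTEGRAL OF A DENSITY WITH A HISTORY-INDEXED EXPANSION IS THE SUM OF ITS WEIGHTS**: if (1.72) holds for
`ρ` with the operations `R K t` (displayed, per level) and every elementary term is integrable,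
then `∫ ρ dμ_K = Σ_{τ ∈ T K} A K t τ` (`integral_finsetSum` twice + M1's `holds_iff_sum_eterm`). [folklore] -/
theorem integral_eq_sum_weight (μ : (K : ℕ) → Measure (X K)) (R : (K : ℕ) → ℝ → Repr172R (𝒢 K) (I K))
    (K : ℕ) (t : ℝ) (ρ : X K → ℝ) (hH : ∀ V, ρ V = ∑ a : (I K).Adm, (R K t).term a V)
    (hint : ∀ a, ∀ ι ∈ (I K).LIdx a, Integrable ((R K t).eterm a ι) (μ K)) :
    ∫ x, ρ x ∂(μ K) = ∑ τ ∈ HIndex.termSet I K, weight μ R t τ := by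
  rw [HIndex.sum_termSet]
  have hρ : ρ = fun x => ∑ a : (I K).Adm, ∑ ι ∈ (I K).LIdx a, (R K t).eterm a ι x :=
    funext (((R K t).holds_iff_sum_eterm ρ).mp hH)
  rw [hρ, integral_finsetSum _ (fun a _ => integrable_finsetSum _ (hint a))]
  refine Finset.sum_congr rfl fun a _ => ?_
  rw [integral_finsetSum _ (hint a)]
  rfl

/-- **JUNCTION TO THE END's `repr` BINDER (one run)**: a displayed identity `Z t = ∫ ρ_t dμ_K` for the source-`t` dressed
partition function (H2's bookkeeping identity, by name from its supplier) + per-level `Holds` + integrability ⟹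
`Z t = Σ_{τ ∈ T K} A K t τ` — the shape of `CountRoadWitnessT3b.reprA` for this cutoff, with `T K` SOURCE-FREE. [folklore] -/
theorem repr_of_holds (μ : (K : ℕ) → Measure (X K)) (R : (K : ℕ) → ℝ → Repr172R (𝒢 K) (I K)) (K : ℕ)
    (Z : ℝ → ℝ) (ρ : ℝ → X K → ℝ) (hZ : ∀ t, Z t = ∫ x, ρ t x ∂(μ K))
    (hH : ∀ t V, ρ t V = ∑ a : (I K).Adm, (R K t).term a V)
    (hint : ∀ t a, ∀ ι ∈ (I K).LIdx a, Integrable ((R K t).eterm a ι) (μ K)) (t : ℝ) :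
    Z t = ∑ τ ∈ HIndex.termSet I K, weight μ R t τ := by
  rw [hZ t]
  exact integral_eq_sum_weight μ R K t (ρ t) (hH t) (hint t)

/-- **TWO RUNS OVER ONE SKELETON** (NODE O's synchronisation as a SHAPE): operations `RA K t` on run A's unit-lattice space
`X K` and `RB K t` on run B's `Y K`, both over the skeleton `I K`, with their displayed `Holds`, integrability and H2
identities, give the END's PAIR `reprA`∕`reprB` over the SAME term set `T K`. [folklore] -/
theorem repr_pair_of_holds {Y : ℕ → Type*} [∀ K, MeasurableSpace (Y K)]
    (μ : (K : ℕ) → Measure (X K)) (ν : (K : ℕ) → Measure (Y K))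
    {𝒢' : (K : ℕ) → GoodClass (Y K)}
    (RA : (K : ℕ) → ℝ → Repr172R (𝒢 K) (I K)) (RB : (K : ℕ) → ℝ → Repr172R (𝒢' K) (I K)) (K : ℕ)
    (ZA ZB : ℝ → ℝ) (ρA : ℝ → X K → ℝ) (ρB : ℝ → Y K → ℝ)
    (hZA : ∀ t, ZA t = ∫ x, ρA t x ∂(μ K)) (hZB : ∀ t, ZB t = ∫ y, ρB t y ∂(ν K))
    (hHA : ∀ t V, ρA t V = ∑ a : (I K).Adm, (RA K t).term a V)
    (hHB : ∀ t V, ρB t V = ∑ a : (I K).Adm, (RB K t).term a V)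
    (hintA : ∀ t a, ∀ ι ∈ (I K).LIdx a, Integrable ((RA K t).eterm a ι) (μ K))
    (hintB : ∀ t a, ∀ ι ∈ (I K).LIdx a, Integrable ((RB K t).eterm a ι) (ν K)) (t : ℝ) :
    ZA t = ∑ τ ∈ HIndex.termSet I K, weight μ RA t τ ∧ ZB t = ∑ τ ∈ HIndex.termSet I K, weight ν RB t τ :=
  ⟨repr_of_holds μ RA K ZA ρA hZA hHA hintA t, repr_of_holds ν RB K ZB ρB hZB hHB hintB t⟩

/-- The weights of non-negative elementary terms are non-negative (L1 integrated: `eterm_nonneg`). [folklore] -/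
theorem weight_nonneg (μ : (K : ℕ) → Measure (X K)) (R : (K : ℕ) → ℝ → Repr172R (𝒢 K) (I K)) (t : ℝ)
    (hχ : ∀ K a V, 0 ≤ (R K t).χ a V) (τ : HIndex.Idx I) : 0 ≤ weight μ R t τ := by
  obtain ⟨K, a, ι⟩ := τ
  exact integral_nonneg fun x => (R K t).eterm_nonneg a ι (hχ K a) x

/-- **U1 INTEGRATED**: under a FINITE reference measure, a uniform pointwise bound on an elementary term (M1's
`abs_eterm_le`: the product of the history's per-operation factors) bounds its weight by that product times the total
mass — the shape `weight ≤ ∏ factor` of the entropy–energy count. [folklore] -/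
theorem abs_weight_le (μ : (K : ℕ) → Measure (X K)) [∀ K, IsFiniteMeasure (μ K)]
    (R : (K : ℕ) → ℝ → Repr172R (𝒢 K) (I K)) (t : ℝ) (K : ℕ) (a : (I K).Adm)
    (ι : (I K).HZ × (I K).HL × (I K).HC) {B : ℝ} (hB : ∀ x, |(R K t).eterm a ι x| ≤ B) :
    |weight μ R t ⟨K, a, ι⟩| ≤ B * (μ K).real Set.univ := by
  show |∫ x, (R K t).eterm a ι x ∂(μ K)| ≤ B * (μ K).real Set.univ
  have h := norm_integral_le_of_norm_le_const (μ := μ K) (f := (R K t).eterm a ι) (C := B)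
    (Filter.Eventually.of_forall fun x => by simpa [Real.norm_eq_abs] using hB x)
  simpa [Real.norm_eq_abs, mul_comm] using h

end Repr172R

end Summit.QuantumFields.BalabanUV.T4Continuum.B16HistoryIndexedRepr
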